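import Literature.Geometry.Riemannian.KernelGradientBound
import Literature.Geometry.Riemannian.HeatKernelEntropyLowerPoint
import Literature.Geometry.Riemannian.HeatKernelForwardMass
import Literature.Geometry.Riemannian.KernelNashEntropyW1Bound
import HarnessLib

/-!
# Bamler's upper volume bound for distance balls (Bamler 2020a, Thm. 8.1, arXiv v1 Thm. 29)

R. Bamler, *Entropy and heat kernel bounds on a Ricci flow background*, arXiv:2008.07093 (2020a),
§8, Thm. 8.1: *"If `[t − r², t] ⊂ I` and `R ≥ R_min` on `M × [t − r², t]`, then for any
`1 ≤ A < ∞`, `|B(x,t,Ar)|_t ≤ C(R_min r²) exp(𝒩_{x,t}(r²)) exp(C₀ A²) rⁿ`."*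

Proved here at general scale `τ = t − s = r²` (the tree has no parabolic rescaling), for a Ricci
flow on `[a, T]` of a smooth family of Riemannian metrics on a closed connected manifold modelled
on `ℝᵐ`, `m ≥ 3`, in the form `exists_riemVolume_ball_le_exp_pointedNashEntropy`: for `Λ ≥ 0`
there are `C, C₂ > 0` depending only on `m, Λ` with

  `vol_t {d_t(x, ·) < A√τ} ≤ C e^{C₂A²} τ^{m/2} e^{𝒩_{x,t}(τ)}`

whenever `a < s < t < T`, `R ≥ R_min` on `M × [s, t]`, `−R_min τ ≤ Λ`, `A ≥ 1`.

Proof (§8.2 of the source, with base time `s` instead of `t − r²/…`): pick `y₀` with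
`K(x,t;y₀,s) ≥ (4πτ)^{-m/2} e^{−𝒩−m/2}` ((8.3), `exists_le_heatKernelFn_of_pointedNashEntropy`) and
put `u = K(·,t;y₀,s)` (a function of the base point). By the gradient bound Thm. 7.5
(`exists_abs_deriv_heatKernelFn_le`) and the Lipschitz bound (8.2) for `𝒩` (Thm. 5.9,
`ofReal_abs_kernelNashEntropy_sub_le`), `v = √(log(E/u))`, `E = C₀τ^{-m/2}e^{−𝒩(x)+√(m/2+Λ)A}`,
has directional derivatives `≤ Cτ^{-1/2}/2` along unit curves in the ball (the log-root trick,
`exists_hasDerivAt_sqrt_log_div`), so `v ≤ v(x) + CA/2 ≤ √(c₂A) + CA/2` on the ball by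
integration along minimising geodesics (`abs_sub_le_mul_edist_of_forall_curve`), i.e.
`u ≥ C₀τ^{-m/2}e^{−𝒩}e^{−C₂A²}` there ((8.6), `le_heatKernelFn_of_edist_lt`); finally
`∫_M u dg_t ≤ e^{−R_min τ} ≤ e^{Λ}` ((7.3), `integral_heatKernelFn_basePoint_le_exp`) bounds the
volume (`riemVolume_ball_le_of_gradient_bound`). Constants are explicit but not optimised.

## References

* R. H. Bamler, *Entropy and heat kernel bounds on a Ricci flow background*, arXiv:2008.07093
  (2020), §8, Thm. 8.1 (arXiv v1 Thm. 29) and its proof, (8.1)–(8.6). [Bamler2020Entropy]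
-/

noncomputable section

open Set Filter Function MeasureTheory Measure
open scoped Manifold ContDiff Topology ENNReal NNReal

namespace Literature.Geometry.Riemannian

open Lorentzian Lorentzian.PseudoRiemannianMetric MetricFlow

/-! ### The log-root trick -/

section LogRoot

/-- **The log-root trick** (Bamler 2020a, §8, proof of Thm. 8.1, the step from
`|∇u|/u ≤ C √(log(C₁ e^{−𝒩+C₁A}/u))` to `|∇v| ≤ C` for `v = √(log(C₁ e^{−𝒩+C₁A}/u))`), one
variable: if `φ > 0` is differentiable at `σ₀` with `|φ'| ≤ c φ √(log(P/φ))` at `σ₀`, `2φ(σ₀) ≤ P`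
and `P ≤ E`, then `σ ↦ √(log(E/φ(σ)))` is differentiable at `σ₀` with derivative of size `≤ c/2`
(its derivative is `−φ'/(2φ√(log(E/φ)))` and `log(P/φ) ≤ log(E/φ)`).
[cite: Bamler2020Entropy, §8, proof of Thm. 8.1] -/
theorem exists_hasDerivAt_sqrt_log_div {φ : ℝ → ℝ} {φ' σ₀ c P E : ℝ} (hφ : HasDerivAt φ φ' σ₀)
    (hpos : 0 < φ σ₀) (h2 : 2 * φ σ₀ ≤ P) (hPE : P ≤ E) (hc : 0 ≤ c)
    (hder : |φ'| ≤ c * φ σ₀ * Real.sqrt (Real.log (P / φ σ₀))) :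
    ∃ ψ' : ℝ, HasDerivAt (fun σ ↦ Real.sqrt (Real.log (E / φ σ))) ψ' σ₀ ∧ |ψ'| ≤ c / 2 := by
  have hP : 0 < P := by linarith only [hpos, h2]
  have hE : 0 < E := hP.trans_le hPE
  have hPp : 2 ≤ P / φ σ₀ := by rw [le_div_iff₀ hpos]; linarith only [h2]
  have hEp : P / φ σ₀ ≤ E / φ σ₀ := div_le_div_of_nonneg_right hPE hpos.le
  have hLP : 0 < Real.log (P / φ σ₀) :=
    (Real.log_pos one_lt_two).trans_le (Real.log_le_log two_pos hPp)
  have hLE : Real.log (P / φ σ₀) ≤ Real.log (E / φ σ₀) :=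
    Real.log_le_log (by positivity) hEp
  have hG₀ : 0 < Real.log (E / φ σ₀) := hLP.trans_le hLE
  have hsG : 0 < Real.sqrt (Real.log (E / φ σ₀)) := Real.sqrt_pos.2 hG₀
  have h1 : HasDerivAt (fun σ ↦ E / φ σ) ((0 * φ σ₀ - E * φ') / φ σ₀ ^ 2) σ₀ :=
    (hasDerivAt_const σ₀ E).div hφ hpos.ne'
  have h2' : HasDerivAt (fun σ ↦ Real.log (E / φ σ))
      (((0 * φ σ₀ - E * φ') / φ σ₀ ^ 2) / (E / φ σ₀)) σ₀ :=
    h1.log (div_pos hE hpos).ne'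
  have h3 := h2'.sqrt hG₀.ne'
  refine ⟨_, h3, ?_⟩
  have e : ((0 * φ σ₀ - E * φ') / φ σ₀ ^ 2 / (E / φ σ₀)) /
      (2 * Real.sqrt (Real.log (E / φ σ₀))) =
      -φ' / (2 * φ σ₀ * Real.sqrt (Real.log (E / φ σ₀))) := by
    field_simp
    ring
  have hden : 0 < 2 * φ σ₀ * Real.sqrt (Real.log (E / φ σ₀)) := by positivity
  rw [e, abs_div, abs_neg, abs_of_pos hden, div_le_div_iff₀ hden two_pos]
  have hs : Real.sqrt (Real.log (P / φ σ₀)) ≤ Real.sqrt (Real.log (E / φ σ₀)) :=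
    Real.sqrt_le_sqrt hLE
  calc |φ'| * 2 ≤ c * φ σ₀ * Real.sqrt (Real.log (P / φ σ₀)) * 2 := by linarith only [hder]
    _ ≤ c * φ σ₀ * Real.sqrt (Real.log (E / φ σ₀)) * 2 :=
        mul_le_mul_of_nonneg_right (mul_le_mul_of_nonneg_left hs (mul_nonneg hc hpos.le))
          zero_le_two
    _ = c * (2 * φ σ₀ * Real.sqrt (Real.log (E / φ σ₀))) := by ring

end LogRoot

/-! ### Radial Lipschitz bound from directional derivative bounds along unit curves -/

section Radial

variable {m : ℕ} {M : Type*} [TopologicalSpace M] [ChartedSpace (EuclideanSpace ℝ (Fin m)) M]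
  [IsManifold 𝓘(ℝ, EuclideanSpace ℝ (Fin m)) ∞ M] [T2Space M] [CompactSpace M] [ConnectedSpace M]

/-- **Radial mean value inequality from directional derivative bounds.** On a compact connected
Riemannian manifold modelled on `ℝᵐ`: if for every `C^∞` curve `γ` with `g(γ̇0, γ̇0) ≤ 1` starting
in the open distance ball `{d(z, ·) < ρ}` the function `σ ↦ F(γ σ)` is differentiable at `0` with
derivative of size `≤ κ`, then `|F x' − F z| ≤ κ d(z, x')` for every `x'` in that ball. Proof:
join `z` to `x'` by a minimising unit-speed geodesic (`exists_unit_minimizing`, Hopf–Rinow); its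
initial segment stays in the ball, the hypothesis applied to its translates bounds the derivative
of `F` along it, and the mean value inequality applies (the integration step of Bamler 2020a, §8,
proof of Thm. 8.1: "`|∇v| ≤ C` on `B(x,0,A)` … implies `v ≤ C√A + CA`").
[cite: Bamler2020Entropy, §8, proof of Thm. 8.1] -/
theorem abs_sub_le_mul_edist_of_forall_curve
    (g : PseudoRiemannianMetric 𝓘(ℝ, EuclideanSpace ℝ (Fin m)) ∞ (EuclideanSpace ℝ (Fin m))
      (TangentSpace 𝓘(ℝ, EuclideanSpace ℝ (Fin m)) : M → Type _)) (hg : g.IsRiemannian)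
    (F : M → ℝ) (z : M) {ρ κ : ℝ}
    (hF : ∀ γ : ℝ → M, ContMDiff 𝓘(ℝ, ℝ) 𝓘(ℝ, EuclideanSpace ℝ (Fin m)) ∞ γ →
      g.val (γ 0) (velocity 𝓘(ℝ, EuclideanSpace ℝ (Fin m)) γ 0)
        (velocity 𝓘(ℝ, EuclideanSpace ℝ (Fin m)) γ 0) ≤ 1 →
      g.edist hg z (γ 0) < ENNReal.ofReal ρ →
      ∃ F' : ℝ, HasDerivAt (fun σ ↦ F (γ σ)) F' 0 ∧ |F'| ≤ κ)
    {x' : M} (hx' : g.edist hg z x' < ENNReal.ofReal ρ) :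
    |F x' - F z| ≤ κ * (g.edist hg z x').toReal := by
  classical
  by_cases hzx : z = x'
  · subst hzx
    -- the constant curve gives `0 ≤ κ`
    obtain ⟨F', -, hb⟩ := hF (fun _ ↦ z) contMDiff_const (by simp [velocity_const]) hx'
    have hκ : 0 ≤ κ := (abs_nonneg _).trans hb
    simp only [sub_self, abs_zero]
    exact mul_nonneg hκ ENNReal.toReal_nonneg
  haveI : Fact ((1 : ℕ∞ω) ≤ (∞ : ℕ∞ω)) := ⟨by exact_mod_cast le_top⟩
  have h2 : (2 : ℕ∞ω) ≤ (∞ : ℕ∞ω) := WithTop.coe_le_coe.mpr le_top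
  haveI := g.hasLeviCivita
  haveI : CovariantDerivative.ContMDiffCovariantDerivative g.leviCivita 1 :=
    contMDiffCovariantDerivative_leviCivita_of_two_le g h2
  haveI : CovariantDerivative.ContMDiffCovariantDerivative g.leviCivita ((⊤ : ℕ∞) : ℕ∞ω) :=
    contMDiffCovariantDerivative_leviCivita_infty g le_rfl
  have hc : IsGeodesicallyComplete g.leviCivita :=
    isGeodesicallyComplete_of_compactSpace g h2 hg
  obtain ⟨u, T₀, hT₀, hu1, hexp, hdist⟩ := exists_unit_minimizing g hg hc hzx
  set γ : ℝ → M := maximalGeodesic g.leviCivita z u with hγ_def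
  have hcurve : ∀ (p : M) (v : TangentSpace 𝓘(ℝ, EuclideanSpace ℝ (Fin m)) p),
      ContMDiff 𝓘(ℝ, ℝ) 𝓘(ℝ, EuclideanSpace ℝ (Fin m)) ∞ (maximalGeodesic g.leviCivita p v) :=
    fun p v ↦ (contMDiff_maximalGeodesic_family hc p).comp
      (contMDiff_id.prodMk (contMDiff_const (c := (show EuclideanSpace ℝ (Fin m) from v))))
  obtain ⟨-, -, hγ0, -⟩ := maximalGeodesic_of_isGeodesicallyComplete hc z u
  have hγ0' : γ 0 = z := hγ0
  have hγT : γ T₀ = x' := by rw [hγ_def, ← expMap_smul hc z u T₀]; exact hexp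
  have hne : g.edist hg z x' ≠ ⊤ := PseudoRiemannianMetric.edist_ne_top hg z x'
  -- derivative and bound at every parameter of the segment
  have hkey : ∀ σ₀ ∈ Icc (0 : ℝ) T₀,
      ∃ F' : ℝ, HasDerivAt (fun σ ↦ F (γ σ)) F' σ₀ ∧ |F'| ≤ κ := by
    intro σ₀ hσ₀
    set γ' : ℝ → M := maximalGeodesic g.leviCivita (γ σ₀)
      (velocity 𝓘(ℝ, EuclideanSpace ℝ (Fin m)) γ σ₀) with hγ'_def
    have hγ'eq : ∀ τ, γ' τ = γ (τ + σ₀) := fun τ ↦ maximalGeodesic_velocity_apply hc z u σ₀ τ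
    have hγ's : ContMDiff 𝓘(ℝ, ℝ) 𝓘(ℝ, EuclideanSpace ℝ (Fin m)) ∞ γ' := hcurve _ _
    have hspeed : g.val (γ' 0) (velocity 𝓘(ℝ, EuclideanSpace ℝ (Fin m)) γ' 0)
        (velocity 𝓘(ℝ, EuclideanSpace ℝ (Fin m)) γ' 0) ≤ 1 := by
      have e1 : g.val (γ' 0) (velocity 𝓘(ℝ, EuclideanSpace ℝ (Fin m)) γ' 0)
          (velocity 𝓘(ℝ, EuclideanSpace ℝ (Fin m)) γ' 0) =
          g.val (γ σ₀) (velocity 𝓘(ℝ, EuclideanSpace ℝ (Fin m)) γ σ₀)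
            (velocity 𝓘(ℝ, EuclideanSpace ℝ (Fin m)) γ σ₀) := by
        rw [hγ'_def]
        exact val_velocity_maximalGeodesic hc _ _ 0
      rw [e1, hγ_def, val_velocity_maximalGeodesic hc z u σ₀, hu1]
    have hd0 : g.edist hg z (γ' 0) < ENNReal.ofReal ρ := by
      rw [hγ'eq 0, zero_add]
      have h1 : g.edist hg z (γ σ₀) ≤ ENNReal.ofReal σ₀ := by
        have h := edist_maximalGeodesic_le hg hc z hu1 hσ₀.1
        rwa [hγ0, sub_zero] at h
      calc g.edist hg z (γ σ₀) ≤ ENNReal.ofReal σ₀ := h1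
        _ ≤ ENNReal.ofReal T₀ := ENNReal.ofReal_le_ofReal hσ₀.2
        _ = g.edist hg z x' := by rw [← hdist, ENNReal.ofReal_toReal hne]
        _ < ENNReal.ofReal ρ := hx'
    obtain ⟨F', hF', hb⟩ := hF γ' hγ's hspeed hd0
    refine ⟨F', ?_, hb⟩
    have h1 : (fun τ ↦ F (γ' τ)) = fun τ ↦ F (γ (τ + σ₀)) := funext fun τ ↦ by rw [hγ'eq τ]
    rw [h1] at hF'
    have hD2 := HasDerivAt.comp_sub_const (f := fun τ ↦ F (γ (τ + σ₀))) σ₀ σ₀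
      (by rw [sub_self]; exact hF')
    have h3 : (fun x ↦ (fun τ ↦ F (γ (τ + σ₀))) (x - σ₀)) = fun σ ↦ F (γ σ) := by
      funext σ; simp only [sub_add_cancel]
    rwa [h3] at hD2
  -- mean value inequality on `[0, T₀]`
  have hMVT := Convex.norm_image_sub_le_of_norm_deriv_le (f := fun σ ↦ F (γ σ)) (s := Icc 0 T₀)
    (C := κ) (fun σ hσ ↦ (hkey σ hσ).choose_spec.1.differentiableAt)
    (fun σ hσ ↦ by
      obtain ⟨F', hF', hb⟩ := hkey σ hσ
      rw [hF'.deriv, Real.norm_eq_abs]; exact hb)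
    (convex_Icc 0 T₀) (left_mem_Icc.2 hT₀.le) (right_mem_Icc.2 hT₀.le)
  rw [Real.norm_eq_abs, Real.norm_eq_abs, sub_zero, abs_of_pos hT₀, hγT, hγ0'] at hMVT
  rw [hdist]
  exact hMVT

end Radial

/-! ### The kernel as a function of its base point: lower bound on a distance ball -/

section Kernel

variable {m : ℕ} {M : Type*} [TopologicalSpace M] [ChartedSpace (EuclideanSpace ℝ (Fin m)) M]
  [IsManifold 𝓘(ℝ, EuclideanSpace ℝ (Fin m)) ∞ M] [T2Space M] [CompactSpace M]
  [SecondCountableTopology M] [MeasurableSpace M] [BorelSpace M] [ConnectedSpace M]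
  {h : ℝ → PseudoRiemannianMetric 𝓘(ℝ, EuclideanSpace ℝ (Fin m)) ∞ (EuclideanSpace ℝ (Fin m))
    (TangentSpace 𝓘(ℝ, EuclideanSpace ℝ (Fin m)) : M → Type _)}
  {cov : ℝ → CovariantDerivative 𝓘(ℝ, EuclideanSpace ℝ (Fin m)) (EuclideanSpace ℝ (Fin m))
    (TangentSpace 𝓘(ℝ, EuclideanSpace ℝ (Fin m)) : M → Type _)}
  {a T : ℝ} (hflow : IsRicciFlow h cov (Icc a T)) (hh : IsContMDiffFamilyOn ∞ h univ)
  (hR : ∀ r, (h r).IsRiemannian)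

/-- **Bamler 2020a, (8.2) at general scale**: for `a < s < t < T`, `R_{g_s} ≥ R_min`,
`−R_min (t − s) ≤ Λ` and `d_t(x, x') < A √(t − s)`,
`𝒩*_s(x, t) − 𝒩*_s(x', t) ≤ √(m/2 + Λ) · A` (the Lipschitz bound of Thm. 5.9,
`ofReal_abs_kernelNashEntropy_sub_le`, times the radius: `√(m/(2τ) − R_min) · A√τ ≤ A √(m/2 + Λ)`).
[cite: Bamler2020Entropy, §8, proof of Thm. 8.1, (8.2)] -/
theorem IsRicciFlow.kernelNashEntropy_sub_le_of_edist_lt (hm : 3 ≤ m) {s t : ℝ} (has : a < s)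
    (hst : s < t) (htT : t < T) {Rmin Λ : ℝ}
    (hRmin : ∀ y, Rmin ≤ (h s).scalarCurvatureWith (cov s) y) (hRΛ : -Rmin * (t - s) ≤ Λ)
    {A : ℝ} (hA : 0 ≤ A) {x x' : M}
    (hx' : (h t).edist (hR t) x x' < ENNReal.ofReal (A * Real.sqrt (t - s))) :
    pointedNashEntropy h (fun r y ↦ hflow.heatKernelFn hh hR t x (y, r)) m t s -
        pointedNashEntropy h (fun r y ↦ hflow.heatKernelFn hh hR t x' (y, r)) m t s ≤
      Real.sqrt ((m : ℝ) / 2 + Λ) * A := by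
  have hτ : 0 < t - s := sub_pos.2 hst
  set L : ℝ := Real.sqrt ((m : ℝ) / (2 * (t - s)) - Rmin) with hL
  have hL0 : 0 ≤ L := Real.sqrt_nonneg _
  have hlip := hflow.ofReal_abs_kernelNashEntropy_sub_le hh hR hm has hst htT hRmin x x'
  have hne : (h t).edist (hR t) x x' ≠ ⊤ := PseudoRiemannianMetric.edist_ne_top (hR t) x x'
  have hdlt : ((h t).edist (hR t) x x').toReal < A * Real.sqrt (t - s) :=
    ENNReal.toReal_lt_of_lt_ofReal hx'
  have hd0 : 0 ≤ ((h t).edist (hR t) x x').toReal := ENNReal.toReal_nonneg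
  rw [← ENNReal.ofReal_toReal hne, ← ENNReal.ofReal_mul hL0,
    ENNReal.ofReal_le_ofReal_iff (mul_nonneg hL0 hd0)] at hlip
  -- `L √τ ≤ √(m/2 + Λ)`
  have hLτ : L * Real.sqrt (t - s) ≤ Real.sqrt ((m : ℝ) / 2 + Λ) := by
    refine sqrt_mul_sqrt_le_sqrt_of_le_div hτ ?_
    have hRmτ : -Rmin ≤ Λ / (t - s) := by rw [le_div_iff₀ hτ]; exact hRΛ
    rw [add_div, div_div]; linarith only [hRmτ]
  calc _ ≤ _ := le_abs_self _
    _ ≤ L * ((h t).edist (hR t) x x').toReal := hlip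
    _ ≤ L * (A * Real.sqrt (t - s)) := mul_le_mul_of_nonneg_left hdlt.le hL0
    _ = A * (L * Real.sqrt (t - s)) := by ring
    _ ≤ A * Real.sqrt ((m : ℝ) / 2 + Λ) := mul_le_mul_of_nonneg_left hLτ hA
    _ = Real.sqrt ((m : ℝ) / 2 + Λ) * A := mul_comm _ _

/-- **Bamler 2020a, (8.6) at general scale: lower bound for the kernel on a distance ball around
the base point.** Let `a < s < t < T`, `τ = t − s`, `R_{g_s} ≥ R_min`, `−R_min τ ≤ Λ`, and
suppose the conclusion of the gradient bound Thm. 7.5 holds at time `t` towards `(y₀, s)` with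
constants `C, C₀` (hypothesis `H75`, cf. `exists_abs_deriv_heatKernelFn_le`), and that
`K(x,t;y₀,s) ≥ (4πτ)^{-m/2} e^{−𝒩 − m/2}`, `𝒩 = 𝒩_{x,t}(τ)` (hypothesis `hy₀`, cf.
`exists_le_heatKernelFn_of_pointedNashEntropy`, (8.3)). Then for `A ≥ 1` and `d_t(x, x') < A√τ`,

  `K(x',t;y₀,s) ≥ C₀ τ^{-m/2} e^{−𝒩} e^{−C₂ A²}`,
  `C₂ = 2(|log C₀ + (m/2) log(4π) + m/2| + √(m/2 + Λ)) + C²/2`.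

Proof (§8.2): with `u = K(·,t;y₀,s)`, `E = C₀ τ^{-m/2} e^{−𝒩 + √(m/2+Λ) A}` and
`v = √(log(E/u))`, (8.2) and Thm. 7.5 give `|∂_σ v(γσ)| ≤ C τ^{-1/2}/2` along unit curves in the
ball (`exists_hasDerivAt_sqrt_log_div`), hence `v(x') ≤ v(x) + CA/2` along a minimising geodesic
(`abs_sub_le_mul_edist_of_forall_curve`), while `v(x)² ≤ |log C₀ + (m/2)log(4π) + m/2| + √(m/2+Λ) A`
by (8.3). [cite: Bamler2020Entropy, §8, proof of Thm. 8.1, (8.4)–(8.6)] -/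
theorem IsRicciFlow.le_heatKernelFn_of_edist_lt (hm : 3 ≤ m) {Λ C C₀ : ℝ}
    (hC : 0 < C) (hC₀ : 0 < C₀) {s t : ℝ} (has : a < s) (hst : s < t) (htT : t < T) {Rmin : ℝ}
    (hRmin : ∀ y, Rmin ≤ (h s).scalarCurvatureWith (cov s) y) (hRΛ : -Rmin * (t - s) ≤ Λ)
    {y₀ : M}
    (H75 : ∀ {γ : ℝ → M}, ContMDiff 𝓘(ℝ, ℝ) 𝓘(ℝ, EuclideanSpace ℝ (Fin m)) ∞ γ →
      (h t).val (γ 0) (velocity 𝓘(ℝ, EuclideanSpace ℝ (Fin m)) γ 0)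
        (velocity 𝓘(ℝ, EuclideanSpace ℝ (Fin m)) γ 0) ≤ 1 →
      2 * hflow.heatKernelFn hh hR t (γ 0) (y₀, s) ≤ C₀ * (t - s) ^ (-(m : ℝ) / 2) *
          Real.exp (-(pointedNashEntropy h
            (fun r' v ↦ hflow.heatKernelFn hh hR t (γ 0) (v, r')) m t s)) ∧
      |deriv (fun σ ↦ hflow.heatKernelFn hh hR t (γ σ) (y₀, s)) 0| ≤
        C * (t - s) ^ (-(1 : ℝ) / 2) * hflow.heatKernelFn hh hR t (γ 0) (y₀, s) *
          Real.sqrt (Real.log (C₀ * (t - s) ^ (-(m : ℝ) / 2) *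
            Real.exp (-(pointedNashEntropy h
              (fun r' v ↦ hflow.heatKernelFn hh hR t (γ 0) (v, r')) m t s)) /
            hflow.heatKernelFn hh hR t (γ 0) (y₀, s))))
    (x : M)
    (hy₀ : (4 * Real.pi * (t - s)) ^ (-(m : ℝ) / 2) *
        Real.exp (-(pointedNashEntropy h (fun r' v ↦ hflow.heatKernelFn hh hR t x (v, r')) m t s)
          - (m : ℝ) / 2) ≤ hflow.heatKernelFn hh hR t x (y₀, s))
    {A : ℝ} (hA : 1 ≤ A) {x' : M}
    (hx' : (h t).edist (hR t) x x' < ENNReal.ofReal (A * Real.sqrt (t - s))) :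
    C₀ * (t - s) ^ (-(m : ℝ) / 2) *
        Real.exp (-(pointedNashEntropy h (fun r' v ↦ hflow.heatKernelFn hh hR t x (v, r')) m t s)) *
        Real.exp (-((2 * (|Real.log C₀ + (m : ℝ) / 2 * Real.log (4 * Real.pi) + (m : ℝ) / 2| +
          Real.sqrt ((m : ℝ) / 2 + Λ)) + C ^ 2 / 2) * A ^ 2)) ≤
      hflow.heatKernelFn hh hR t x' (y₀, s) := by
  classical
  have hτ : 0 < t - s := sub_pos.2 hst
  have ht : t ∈ Ioc a T := ⟨has.trans hst, htT.le⟩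
  have hA0 : 0 ≤ A := zero_le_one.trans hA
  have hπ := Real.pi_pos
  -- notation
  set N : M → ℝ := fun z ↦
    pointedNashEntropy h (fun r' v ↦ hflow.heatKernelFn hh hR t z (v, r')) m t s with hN
  set u : M → ℝ := fun z ↦ hflow.heatKernelFn hh hR t z (y₀, s) with hu
  have hupos : ∀ z, 0 < u z := fun z ↦ hflow.heatKernelFn_pos hh hR ht z ⟨mem_univ _, has, hst⟩
  set c₁ : ℝ := Real.sqrt ((m : ℝ) / 2 + Λ) with hc₁
  have hc₁0 : 0 ≤ c₁ := Real.sqrt_nonneg _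
  set c₀ : ℝ := Real.log C₀ + (m : ℝ) / 2 * Real.log (4 * Real.pi) + (m : ℝ) / 2 with hc₀
  set c₂ : ℝ := |c₀| + c₁ with hc₂
  have hc₂0 : 0 ≤ c₂ := add_nonneg (abs_nonneg _) hc₁0
  set c₃ : ℝ := 2 * c₂ + C ^ 2 / 2 with hc₃
  have hτpow : 0 < (t - s) ^ (-(m : ℝ) / 2) := Real.rpow_pos_of_pos hτ _
  set P₀ : ℝ := C₀ * (t - s) ^ (-(m : ℝ) / 2) with hP₀
  have hP₀0 : 0 < P₀ := mul_pos hC₀ hτpow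
  set E : ℝ := P₀ * Real.exp (-N x + c₁ * A) with hE
  have hE0 : 0 < E := mul_pos hP₀0 (Real.exp_pos _)
  -- (8.2): `P₀ e^{-𝒩(z)} ≤ E` on the ball
  have hPE : ∀ z, (h t).edist (hR t) x z < ENNReal.ofReal (A * Real.sqrt (t - s)) →
      P₀ * Real.exp (-N z) ≤ E := by
    intro z hz
    have hcmp := hflow.kernelNashEntropy_sub_le_of_edist_lt hh hR hm has hst htT hRmin hRΛ hA0 hz
    refine mul_le_mul_of_nonneg_left (Real.exp_le_exp.2 ?_) hP₀0.le
    change N x - N z ≤ c₁ * A at hcmp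
    linarith only [hcmp]
  -- `2u ≤ P₀ e^{-𝒩}` everywhere (Thm. 7.5 along constant curves)
  have h2u : ∀ z, 2 * u z ≤ P₀ * Real.exp (-N z) := fun z ↦
    (H75 (γ := fun _ ↦ z) contMDiff_const (by simp [velocity_const])).1
  have hEu : ∀ z, (h t).edist (hR t) x z < ENNReal.ofReal (A * Real.sqrt (t - s)) →
      2 ≤ E / u z := fun z hz ↦ by
    rw [le_div_iff₀ (hupos z)]; linarith only [h2u z, hPE z hz]
  have hGpos : ∀ z, (h t).edist (hR t) x z < ENNReal.ofReal (A * Real.sqrt (t - s)) →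
      0 < Real.log (E / u z) := fun z hz ↦
    (Real.log_pos one_lt_two).trans_le (Real.log_le_log two_pos (hEu z hz))
  -- the function `F = √(log(E/u))` and its directional derivative bound
  set F : M → ℝ := fun z ↦ Real.sqrt (Real.log (E / u z)) with hF
  set κ : ℝ := C * (t - s) ^ (-(1 : ℝ) / 2) / 2 with hκ
  have hCτ : 0 ≤ C * (t - s) ^ (-(1 : ℝ) / 2) := mul_nonneg hC.le (Real.rpow_nonneg hτ.le _)
  have hκ0 : 0 ≤ κ := by rw [hκ]; linarith only [hCτ]
  have hdir : ∀ γ : ℝ → M, ContMDiff 𝓘(ℝ, ℝ) 𝓘(ℝ, EuclideanSpace ℝ (Fin m)) ∞ γ →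
      (h t).val (γ 0) (velocity 𝓘(ℝ, EuclideanSpace ℝ (Fin m)) γ 0)
        (velocity 𝓘(ℝ, EuclideanSpace ℝ (Fin m)) γ 0) ≤ 1 →
      (h t).edist (hR t) x (γ 0) < ENNReal.ofReal (A * Real.sqrt (t - s)) →
      ∃ F' : ℝ, HasDerivAt (fun σ ↦ F (γ σ)) F' 0 ∧ |F'| ≤ κ := by
    intro γ hγ h1 hγ0
    obtain ⟨h2, hder⟩ := H75 hγ h1
    have hφ := hflow.hasDerivAt_heatKernelFn_curve hh hR has hst htT hγ y₀ 0
    obtain ⟨ψ', hψ', hb⟩ :=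
      exists_hasDerivAt_sqrt_log_div (E := E) hφ (hupos (γ 0)) h2 (hPE (γ 0) hγ0) hCτ hder
    exact ⟨ψ', hψ', hb⟩
  -- radial Lipschitz bound: `F x' ≤ F x + C A / 2`
  have hLip := abs_sub_le_mul_edist_of_forall_curve (h t) (hR t) F x hdir hx'
  have hdlt : ((h t).edist (hR t) x x').toReal < A * Real.sqrt (t - s) :=
    ENNReal.toReal_lt_of_lt_ofReal hx'
  have hκA : κ * (A * Real.sqrt (t - s)) = C * A / 2 := by
    have hsqτ : (t - s) ^ (-(1 : ℝ) / 2) * Real.sqrt (t - s) = 1 := by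
      rw [Real.sqrt_eq_rpow, ← Real.rpow_add hτ]; norm_num
    rw [hκ]
    calc _ = C * A / 2 * ((t - s) ^ (-(1 : ℝ) / 2) * Real.sqrt (t - s)) := by ring
      _ = _ := by rw [hsqτ, mul_one]
  have hFx' : F x' ≤ F x + C * A / 2 := by
    have h1 : F x' - F x ≤ κ * (A * Real.sqrt (t - s)) :=
      ((le_abs_self _).trans hLip).trans (mul_le_mul_of_nonneg_left hdlt.le hκ0)
    rw [hκA] at h1; linarith only [h1]
  -- at the centre: `log(E/u x) ≤ c₀ + c₁ A ≤ c₂ A` by (8.3)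
  have hGx : Real.log (E / u x) ≤ c₀ + c₁ * A := by
    have h4π : 0 < 4 * Real.pi := by positivity
    have hlowpow : 0 < (4 * Real.pi * (t - s)) ^ (-(m : ℝ) / 2) :=
      Real.rpow_pos_of_pos (mul_pos h4π hτ) _
    have hlow : 0 < (4 * Real.pi * (t - s)) ^ (-(m : ℝ) / 2) * Real.exp (-N x - (m : ℝ) / 2) :=
      mul_pos hlowpow (Real.exp_pos _)
    have hy₀' : (4 * Real.pi * (t - s)) ^ (-(m : ℝ) / 2) * Real.exp (-N x - (m : ℝ) / 2) ≤ u x :=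
      hy₀
    have h1 := Real.log_le_log hlow hy₀'
    have h2 : Real.log E = Real.log C₀ + (-(m : ℝ) / 2) * Real.log (t - s) + (-N x + c₁ * A) := by
      rw [hE, hP₀, Real.log_mul hP₀0.ne' (Real.exp_pos _).ne', Real.log_mul hC₀.ne' hτpow.ne',
        Real.log_rpow hτ, Real.log_exp]
    have h3 : Real.log ((4 * Real.pi * (t - s)) ^ (-(m : ℝ) / 2) * Real.exp (-N x - (m : ℝ) / 2))
        = (-(m : ℝ) / 2) * (Real.log (4 * Real.pi) + Real.log (t - s)) + (-N x - (m : ℝ) / 2) := by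
      rw [Real.log_mul hlowpow.ne' (Real.exp_pos _).ne', Real.log_rpow (mul_pos h4π hτ),
        Real.log_exp, Real.log_mul h4π.ne' hτ.ne']
    rw [Real.log_div hE0.ne' (hupos x).ne', h2]
    rw [h3] at h1
    rw [hc₀]
    linarith only [h1]
  have hGx' : Real.log (E / u x) ≤ c₂ * A := by
    have h1 : c₀ ≤ |c₀| * A := by
      have := le_abs_self c₀
      nlinarith only [this, abs_nonneg c₀, hA]
    calc _ ≤ c₀ + c₁ * A := hGx
      _ ≤ |c₀| * A + c₁ * A := by linarith only [h1]
      _ = c₂ * A := by rw [hc₂]; ring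
  have hFx : F x ≤ Real.sqrt (c₂ * A) := Real.sqrt_le_sqrt hGx'
  -- so `log(E/u x') = (F x')² ≤ (√(c₂A) + CA/2)² ≤ c₃ A²`
  have hR₀ : F x' ≤ Real.sqrt (c₂ * A) + C * A / 2 := by linarith only [hFx', hFx]
  have hsq : (Real.sqrt (c₂ * A) + C * A / 2) ^ 2 ≤ c₃ * A ^ 2 := by
    have hc₂A : 0 ≤ c₂ * A := mul_nonneg hc₂0 hA0
    have e1 : Real.sqrt (c₂ * A) ^ 2 = c₂ * A := Real.sq_sqrt hc₂A
    have hAA : A ≤ A ^ 2 := by nlinarith only [hA]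
    calc (Real.sqrt (c₂ * A) + C * A / 2) ^ 2
        ≤ 2 * Real.sqrt (c₂ * A) ^ 2 + 2 * (C * A / 2) ^ 2 := by
          nlinarith only [sq_nonneg (Real.sqrt (c₂ * A) - C * A / 2)]
      _ = 2 * c₂ * A + C ^ 2 / 2 * A ^ 2 := by rw [e1]; ring
      _ ≤ 2 * c₂ * A ^ 2 + C ^ 2 / 2 * A ^ 2 := by nlinarith only [hAA, hc₂0]
      _ = c₃ * A ^ 2 := by rw [hc₃]; ring
  have hG' : Real.log (E / u x') ≤ c₃ * A ^ 2 := by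
    have e : Real.log (E / u x') = F x' ^ 2 := (Real.sq_sqrt (hGpos x' hx').le).symm
    rw [e]
    exact (pow_le_pow_left₀ (Real.sqrt_nonneg _) hR₀ 2).trans hsq
  -- `u x' = E e^{-log(E/u x')} ≥ E e^{-c₃ A²} ≥ P₀ e^{-𝒩(x)} e^{-c₃ A²}`
  have hux' : E * Real.exp (-Real.log (E / u x')) = u x' := by
    rw [Real.exp_neg, Real.exp_log (div_pos hE0 (hupos x')), inv_div, mul_div_cancel₀ _ hE0.ne']
  have hEge : P₀ * Real.exp (-N x) ≤ E := by
    rw [hE]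
    refine mul_le_mul_of_nonneg_left (Real.exp_le_exp.2 ?_) hP₀0.le
    linarith only [mul_nonneg hc₁0 hA0]
  calc P₀ * Real.exp (-N x) * Real.exp (-(c₃ * A ^ 2))
      ≤ E * Real.exp (-(c₃ * A ^ 2)) := mul_le_mul_of_nonneg_right hEge (Real.exp_pos _).le
    _ ≤ E * Real.exp (-Real.log (E / u x')) :=
        mul_le_mul_of_nonneg_left (Real.exp_le_exp.2 (neg_le_neg hG')) hE0.le
    _ = u x' := hux'

/-- **Bamler 2020a, Thm. 8.1 (arXiv v1 Thm. 29) at general scale, for a fixed flow, given the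
gradient bound of Thm. 7.5 at time `t` with constants `C, C₀`** (hypothesis `H75`, discharged by
`exists_abs_deriv_heatKernelFn_le`): for `a < s < t < T`, `τ = t − s`, `R ≥ R_min` on
`M × [s, t]`, `−R_min τ ≤ Λ`, `A ≥ 1`,

  `|B(x, t, A√τ)|_t ≤ (e^{Λ}/C₀) e^{C₂ A²} τ^{m/2} e^{𝒩_{x,t}(τ)}`,
  `C₂ = 2(|log C₀ + (m/2) log(4π) + m/2| + √(m/2 + Λ)) + C²/2`.

Proof (§8.2): pick `y₀` with `K(x,t;y₀,s) ≥ (4πτ)^{-m/2}e^{−𝒩−m/2}` ((8.3),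
`exists_le_heatKernelFn_of_pointedNashEntropy`); then `u = K(·,t;y₀,s) ≥ C₀τ^{-m/2}e^{−𝒩}e^{−C₂A²}`
on the ball ((8.6), `le_heatKernelFn_of_edist_lt`) while `∫_M u dg_t ≤ e^{−R_min τ} ≤ e^{Λ}`
((7.3), `integral_heatKernelFn_basePoint_le_exp`). [cite: Bamler2020Entropy, §8, Thm. 8.1 (arXiv v1 Thm. 29)] -/
theorem IsRicciFlow.riemVolume_ball_le_of_gradient_bound (hm : 3 ≤ m) {Λ C C₀ : ℝ}
    (hC : 0 < C) (hC₀ : 0 < C₀) {s t : ℝ} (has : a < s) (hst : s < t) (htT : t < T) {Rmin : ℝ}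
    (hRmin : ∀ r ∈ Icc s t, ∀ z : M, Rmin ≤ (h r).scalarCurvatureWith (cov r) z)
    (hRΛ : -Rmin * (t - s) ≤ Λ)
    (H75 : ∀ {γ : ℝ → M}, ContMDiff 𝓘(ℝ, ℝ) 𝓘(ℝ, EuclideanSpace ℝ (Fin m)) ∞ γ →
      (h t).val (γ 0) (velocity 𝓘(ℝ, EuclideanSpace ℝ (Fin m)) γ 0)
        (velocity 𝓘(ℝ, EuclideanSpace ℝ (Fin m)) γ 0) ≤ 1 →
      ∀ y : M,
      2 * hflow.heatKernelFn hh hR t (γ 0) (y, s) ≤ C₀ * (t - s) ^ (-(m : ℝ) / 2) *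
          Real.exp (-(pointedNashEntropy h
            (fun r' v ↦ hflow.heatKernelFn hh hR t (γ 0) (v, r')) m t s)) ∧
      |deriv (fun σ ↦ hflow.heatKernelFn hh hR t (γ σ) (y, s)) 0| ≤
        C * (t - s) ^ (-(1 : ℝ) / 2) * hflow.heatKernelFn hh hR t (γ 0) (y, s) *
          Real.sqrt (Real.log (C₀ * (t - s) ^ (-(m : ℝ) / 2) *
            Real.exp (-(pointedNashEntropy h
              (fun r' v ↦ hflow.heatKernelFn hh hR t (γ 0) (v, r')) m t s)) /
            hflow.heatKernelFn hh hR t (γ 0) (y, s))))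
    (x : M) {A : ℝ} (hA : 1 ≤ A) :
    (h t).riemVolume {y | (h t).edist (hR t) x y < ENNReal.ofReal (A * Real.sqrt (t - s))} ≤
      ENNReal.ofReal (Real.exp Λ / C₀ *
        Real.exp ((2 * (|Real.log C₀ + (m : ℝ) / 2 * Real.log (4 * Real.pi) + (m : ℝ) / 2| +
          Real.sqrt ((m : ℝ) / 2 + Λ)) + C ^ 2 / 2) * A ^ 2) * (t - s) ^ ((m : ℝ) / 2) *
        Real.exp (pointedNashEntropy h (fun r' v ↦ hflow.heatKernelFn hh hR t x (v, r')) m t s)) := by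
  classical
  have hτ : 0 < t - s := sub_pos.2 hst
  have ht : t ∈ Ioc a T := ⟨has.trans hst, htT.le⟩
  obtain ⟨y₀, hy₀⟩ := exists_le_heatKernelFn_of_pointedNashEntropy hflow hh hR has hst htT.le x
  set c₃ : ℝ := 2 * (|Real.log C₀ + (m : ℝ) / 2 * Real.log (4 * Real.pi) + (m : ℝ) / 2| +
    Real.sqrt ((m : ℝ) / 2 + Λ)) + C ^ 2 / 2 with hc₃
  set N : ℝ := pointedNashEntropy h (fun r' v ↦ hflow.heatKernelFn hh hR t x (v, r')) m t s
    with hN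
  set u : M → ℝ := fun z ↦ hflow.heatKernelFn hh hR t z (y₀, s) with hu
  have hτpow : 0 < (t - s) ^ (-(m : ℝ) / 2) := Real.rpow_pos_of_pos hτ _
  set ℓ : ℝ := C₀ * (t - s) ^ (-(m : ℝ) / 2) * Real.exp (-N) * Real.exp (-(c₃ * A ^ 2)) with hℓ
  have hℓ0 : 0 < ℓ := mul_pos (mul_pos (mul_pos hC₀ hτpow) (Real.exp_pos _)) (Real.exp_pos _)
  have hball : ∀ x', (h t).edist (hR t) x x' < ENNReal.ofReal (A * Real.sqrt (t - s)) →
      ℓ ≤ u x' := fun x' hx' ↦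
    hflow.le_heatKernelFn_of_edist_lt hh hR hm hC hC₀ has hst htT (hRmin s ⟨le_rfl, hst.le⟩) hRΛ
      (fun hγ h1 ↦ H75 hγ h1 y₀) x hy₀ hA hx'
  -- the mass bound (7.3)
  have hmass : ∫ z, u z ∂(h t).riemVolume ≤ Real.exp Λ :=
    (integral_heatKernelFn_basePoint_le_exp hflow hh hR has hst htT.le hRmin y₀).trans
      (Real.exp_le_exp.2 hRΛ)
  -- integrate the lower bound over the ball
  set μ : Measure M := (h t).riemVolume with hμ
  haveI : IsFiniteMeasure μ := ⟨(h t).riemVolume_univ_lt_top⟩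
  set B : Set M := {y | (h t).edist (hR t) x y < ENNReal.ofReal (A * Real.sqrt (t - s))} with hB
  have hdc : Continuous fun y ↦ (h t).edist (hR t) x y :=
    ((h t).continuous_edist (hR t)).comp (.prodMk_right x)
  have hBm : MeasurableSet B := measurableSet_lt hdc.measurable measurable_const
  have huc : Continuous u :=
    hflow.continuous_heatKernelFn_basePoint_slice hh hR ht (p := (y₀, s)) ⟨has, hst⟩
  have hupos : ∀ z, 0 < u z := fun z ↦ hflow.heatKernelFn_pos hh hR ht z ⟨mem_univ _, has, hst⟩
  have hui : Integrable u μ := (h t).integrable_of_continuous huc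
  have h1 : ∫ z in B, u z ∂μ ≤ ∫ z, u z ∂μ :=
    setIntegral_le_integral hui (Eventually.of_forall fun z ↦ (hupos z).le)
  have h2 : ∫ _ in B, ℓ ∂μ ≤ ∫ z in B, u z ∂μ :=
    setIntegral_mono_on (integrableOn_const (measure_ne_top μ B)) hui.integrableOn hBm
      fun z hz ↦ hball z hz
  rw [setIntegral_const, smul_eq_mul] at h2
  have h3 : μ.real B * ℓ ≤ Real.exp Λ := (h2.trans h1).trans hmass
  have h4 : μ.real B ≤ Real.exp Λ / ℓ := by rw [le_div_iff₀ hℓ0]; exact h3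
  have h5 : Real.exp Λ / ℓ =
      Real.exp Λ / C₀ * Real.exp (c₃ * A ^ 2) * (t - s) ^ ((m : ℝ) / 2) * Real.exp N := by
    have hpow' : 0 < (t - s) ^ ((m : ℝ) / 2) := Real.rpow_pos_of_pos hτ _
    rw [hℓ, neg_div, Real.rpow_neg hτ.le, Real.exp_neg, Real.exp_neg]
    field_simp
  calc μ B = ENNReal.ofReal (μ.real B) := (ofReal_measureReal (measure_ne_top μ B)).symm
    _ ≤ _ := ENNReal.ofReal_le_ofReal (h4.trans_eq h5)

end Kernel

/-! ### Bamler 2020a, Thm. 8.1 -/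

/-- **Bamler 2020a, Thm. 8.1 (arXiv v1 Thm. 29): upper volume bound for distance balls.** For
every `m ≥ 3` and `Λ ≥ 0` there are constants `C, C₂ > 0` (depending only on `m`, `Λ`) such that
for every Ricci flow `hflow` on `[a, T]` of a smooth family of Riemannian metrics on a closed
connected manifold modelled on `ℝᵐ`, all `a < s < t < T` with `R ≥ R_min` on `M × [s, t]` and
`−R_min (t − s) ≤ Λ`, every `x` and every `A ≥ 1`, writing `τ = t − s` and
`𝒩 = 𝒩_{x,t}(τ)` for the pointed Nash entropy of the conjugate heat kernel based at `(x, t)`: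

  `vol_{g_t} {y | d_t(x, y) < A √τ} ≤ C e^{C₂ A²} τ^{m/2} e^{𝒩}`

("`|B(x,t,Ar)|_t ≤ C(R_min r²) exp(𝒩_{x,t}(r²)) exp(C₀A²) rⁿ`"). Proof: §8.2 of the source at
general scale — (8.3) a point `y₀` where `K(x,t;·,s)` is not small, the gradient bound Thm. 7.5
and the entropy Lipschitz bound (8.2) give via `v = √(log(E/u))` the lower bound (8.6) for
`u = K(·,t;y₀,s)` on the ball, and the mass bound `∫ u dg_t ≤ e^{−R_min τ}` (7.3) concludes.
[cite: Bamler2020Entropy, §8, Thm. 8.1 (arXiv v1 Thm. 29)] -/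
theorem exists_riemVolume_ball_le_exp_pointedNashEntropy (m : ℕ) (hm : 3 ≤ m) {Λ : ℝ}
    (hΛ : 0 ≤ Λ) :
    ∃ C C₂ : ℝ, 0 < C ∧ 0 < C₂ ∧ ∀ {M : Type*} [TopologicalSpace M]
      [ChartedSpace (EuclideanSpace ℝ (Fin m)) M]
      [IsManifold 𝓘(ℝ, EuclideanSpace ℝ (Fin m)) ∞ M] [T2Space M] [CompactSpace M]
      [SecondCountableTopology M] [MeasurableSpace M] [BorelSpace M] [ConnectedSpace M]
      {h : ℝ → PseudoRiemannianMetric 𝓘(ℝ, EuclideanSpace ℝ (Fin m)) ∞ (EuclideanSpace ℝ (Fin m))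
        (TangentSpace 𝓘(ℝ, EuclideanSpace ℝ (Fin m)) : M → Type _)}
      {cov : ℝ → CovariantDerivative 𝓘(ℝ, EuclideanSpace ℝ (Fin m)) (EuclideanSpace ℝ (Fin m))
        (TangentSpace 𝓘(ℝ, EuclideanSpace ℝ (Fin m)) : M → Type _)}
      {a T : ℝ} (hflow : IsRicciFlow h cov (Icc a T)) (hh : IsContMDiffFamilyOn ∞ h univ)
      (hR : ∀ r, (h r).IsRiemannian),
      ∀ {s t : ℝ}, a < s → s < t → t < T → ∀ {Rmin : ℝ},
      (∀ r ∈ Icc s t, ∀ z : M, Rmin ≤ (h r).scalarCurvatureWith (cov r) z) →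
      -Rmin * (t - s) ≤ Λ → ∀ (x : M) {A : ℝ}, 1 ≤ A →
      (h t).riemVolume {y | (h t).edist (hR t) x y < ENNReal.ofReal (A * Real.sqrt (t - s))} ≤
        ENNReal.ofReal (C * Real.exp (C₂ * A ^ 2) * (t - s) ^ ((m : ℝ) / 2) *
          Real.exp (pointedNashEntropy h (fun r' v ↦ hflow.heatKernelFn hh hR t x (v, r')) m t s)) := by
  obtain ⟨Cg, C₀, hCg, hC₀, H75⟩ := exists_abs_deriv_heatKernelFn_le m hm hΛ
  refine ⟨Real.exp Λ / C₀,
    2 * (|Real.log C₀ + (m : ℝ) / 2 * Real.log (4 * Real.pi) + (m : ℝ) / 2| +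
      Real.sqrt ((m : ℝ) / 2 + Λ)) + Cg ^ 2 / 2, by positivity, by positivity, ?_⟩
  intro M _ _ _ _ _ _ _ _ _ h cov a T hflow hh hR s t has hst htT Rmin hRmin hRΛ x A hA
  exact hflow.riemVolume_ball_le_of_gradient_bound hh hR hm hCg hC₀ has hst htT hRmin hRΛ
    (fun hγ h1 y ↦ H75 hflow hh hR has hst htT hRmin hRΛ hγ h1 y) x hA

end Literature.Geometry.Riemannian

end
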